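import Summits.QuantumFields.BalabanUV.T4Continuum.Support.B13Readings
import Summits.QuantumFields.BalabanUV.T4Continuum.Support.DecayRateInterpolation
import Summits.QuantumFields.BalabanUV.T4Continuum.Spine.CoerciveInverseTower

/-!
# B13ReadingsImage — row O4-r: OPERATOR-LIPSCHITZ IMAGES OF A TOWER MEMBER (two-level operator-norm rate ⟹ King's decay shape)
# and THE TOWER READINGS OF THE Δ SPECIES (`deltaKer`, `gammaConstituent`) IN THE DECAY CURRENCY OF RECORD — generic part
# (file 1 of 3 of the (M1-Δ) item of the NE5 verdict sheet §9; file 2 = `B13ReadingsDelta`, the Bałaban tier-B instance; file 3 =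
# `B13ReadingsAssembly`, the five species conjuncts assembled into the END-of-record W1 binder `hwer`)

Cell `pub-balaban`, unit `b2b-balaban-t4-ne5-p1` (row NE5 OWNER, gen 34; owner item «g34-a»; O4-r species readings into `RawSpecies`
slots are the owner's by DESIGN RULE R41).  Summits-side NEW WORK under the LEAN PLACEMENT RULE (readings = identifications +
bookkeeping + [folklore] linear algebra; print cited for KIND only).  HONEST FRAMING: rung (B)+1 of the FINITE-VOLUME T⁴ continuum
programme — NOT infinite volume, NOT a mass gap, NOT the Clay problem, NOT a proof of NE5 (NOT PRINTED: the series prints ε-UNIFORM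
bounds, never η-RATES; GAPS G-t4-U3-1), NOT a proof of NE2 or NE3.  HONEST DEPENDENCY (cell, verbatim): continuum YM on T⁴ ⇐ BetaPertH ∧
nine spine estimates (0/9 proved); BetaPertH ⇐ (D1) ∧ (D4) ∧ CAP+tail; G-an2-4 gates asym, D1 and NE2/3/4.

THE POINT (bookkeeping; no estimate on Bałaban's objects).  W1 OF RECORD (`B13StepEndInsOp.ne5_of_record_insOp`, binder `hwer`) is the
conjunction of five `B13Readings.SpeciesEntryBound` conjuncts (`B13ReadingsLocal.speciesEntryBound_of_rates`): the covariance conjunct is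
read from row NE2's tower member in the decay currency (`B13ReadingsDecay`), the two potential conjuncts from node NE3's `LocalRate` through
Lipschitz readings (`B13ReadingsLocal`).  The two remaining species — the kernel `A = C*Δ_k(σ)C` under the square root (`deltaKer`) and the
constituent `L` of `Γ_k(Z₀, σ(Z)) = C*Δ_k(σ(Z))C Z₀^c (C^{(k)})^{1/2}(σ(Z))` (`gammaConstituent`), [Balaban1988RG2Cluster] (2.14) p. 15 (KIND
only) — are, at model level, functions of the SAME tower member `c_k` (the unit-lattice background covariance): images under maps `Φ_t`
that are LIPSCHITZ IN OPERATOR NORM on a set containing every level — fixed sandwiches `X ↦ PXQ`, affine maps `X ↦ A₀ + β•X` (e.g. the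
`δ`-function operator `Δ_k = a − a²·Q_kG_kQ_kᴴ` of a Gaussian average is affine in the sandwiched resolvent), INVERSES on uniformly
coercive matrices (`CoerciveInverseTower.opNorm_inv_sub_inv_le`), and their composites.  WHICH `Φ_t` realises `A` and `L` on Bałaban's
member is the substrate's O-8 dictionary (`slotsOfRecord`) — model level, asserted by nobody.

§1 (generic, [folklore]) `OpLipschitzOn S Φ Λ` (`‖Φ X − Φ Y‖ ≤ Λ‖X − Y‖` on `S`; bridge from Mathlib's `LipschitzOnWith`); the instances
   affine ∕ sandwich ∕ inverse-on-coercive ∕ composition; **`twoLevel_opRate`** (a two-level operator-norm rate `‖c_{k+1} − c_k‖ ≤ Cρ^k` of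
   a family staying in `S` transports to `Φ ∘ c` with constant `ΛC`) and **`twoLevelDecayRate_image`** (with a level-uniform `EntryDecay`
   of the images: King's (4.38) two-level shape `TwoLevelDecayRate dist (Φ ∘ c) √(2B·ΛC) (δ∕2) √ρ`, `DecayRateInterpolation` BY NAME).
§2 (generic) the READINGS `ReadsTowerDeltaA∕B` (run A's `deltaKer t i j` at step `k` IS entry `(σX t i, σX t j)` of the level-`k` image
   `dk j t k` of member `j = tow k g U` at slot `t`; run B = level `k + 1` of the SAME member and slot — the tower road's MI-R),
   `ReadsTowerGammaA∕B` (entry `(σB t a′, σX t i)`), the format dominations `Delta∕GammaWeightDominatesDist`, and the faces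
   `deltaKer∕gammaConstituent_formatBy_of_entryDecay` (one run, radius `B`) ∕ **`…_entryBound_of_twoLevelDecayRate`** (two runs: the
   `SpeciesEntryBound` conjuncts `≤ B·θ^k·wt`, NO `1 ∕ min wt` loss) — exactly parallel to `B13ReadingsDecay` §1 for the covariance.
HONEST: statements OURS; every `def` is a parametrised HYPOTHESIS SHAPE (tagged), asserted by nobody; NE5 ∕ NE2 ∕ NE3 NOT proved; 0∕12
leaves on Bałaban's concrete objects; spine 0∕9.  `FlowStep.BetaPertH`, (B), (B^μ) do not occur.  ABSOLUTE RULE kept; 0 sorry.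
-/

noncomputable section

open scoped BigOperators ComplexConjugate Matrix Matrix.Norms.L2Operator

namespace Summit.QuantumFields.BalabanUV.T4Continuum.B13ReadingsImage

open Summit.QuantumFields.BalabanUV.T4Continuum
open Summit.QuantumFields.BalabanUV.T4Continuum.B13OpDatum
open Summit.QuantumFields.BalabanUV.T4Continuum.B13Readings (SpeciesFormatBy SpeciesEntryBound)
open Summit.QuantumFields.BalabanUV.T4Continuum.DecayRateInterpolation (EntryDecay TwoLevelDecayRate
  twoLevelDecayRate_of_opNorm_of_entryDecay)
open Summit.QuantumFields.BalabanUV.T4Continuum.CoerciveInverseTower (Coercive opNorm_inv_sub_inv_le)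

/-! ## §1 Operator-Lipschitz images of a family with a two-level operator-norm rate (generic) -/

section Lipschitz

variable {E F G : Type*} [SeminormedAddCommGroup E] [SeminormedAddCommGroup F] [SeminormedAddCommGroup G]

/-- HYPOTHESIS SHAPE **`OpLipschitzOn S Φ Λ`**: the map `Φ` is `Λ`-Lipschitz IN NORM on the set `S` —
`‖Φ X − Φ Y‖ ≤ Λ·‖X − Y‖` for `X, Y ∈ S` (real constant; Mathlib's `LipschitzOnWith` with an `ℝ≥0` constant implies it,
`of_lipschitzOnWith`).  The READING of a derived species says its kernel is `Φ (c_k)` for such a `Φ`. [folklore] -/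
@[folklore]
def OpLipschitzOn (S : Set E) (Φ : E → F) (Λ : ℝ) : Prop :=
  ∀ ⦃X⦄, X ∈ S → ∀ ⦃Y⦄, Y ∈ S → ‖Φ X - Φ Y‖ ≤ Λ * ‖X - Y‖

/-- [folklore] Mathlib's `LipschitzOnWith K S Φ` gives `OpLipschitzOn S Φ K`. -/
theorem OpLipschitzOn.of_lipschitzOnWith {S : Set E} {Φ : E → F} {K : NNReal} (h : LipschitzOnWith K Φ S) :
    OpLipschitzOn S Φ K := fun _ hX _ hY => h.norm_sub_le hX hY

/-- [folklore] Conversely `OpLipschitzOn S Φ Λ` is Mathlib's `LipschitzOnWith (Real.toNNReal Λ) Φ S` (pseudo-metric sources∕targets) —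
the shape is a real-constant repackaging, not a new notion. -/
theorem OpLipschitzOn.toLipschitzOnWith {S : Set E} {Φ : E → F} {Λ : ℝ} (h : OpLipschitzOn S Φ Λ) :
    LipschitzOnWith (Real.toNNReal Λ) Φ S :=
  LipschitzOnWith.of_dist_le' fun _ hX _ hY => by rw [dist_eq_norm, dist_eq_norm]; exact h hX hY

/-- [folklore] Monotonicity in the constant and the set. -/
theorem OpLipschitzOn.mono {S S' : Set E} {Φ : E → F} {Λ Λ' : ℝ} (h : OpLipschitzOn S Φ Λ) (hS : S' ⊆ S) (hΛ : Λ ≤ Λ') :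
    OpLipschitzOn S' Φ Λ' := fun _ hX _ hY =>
  (h (hS hX) (hS hY)).trans (mul_le_mul_of_nonneg_right hΛ (norm_nonneg _))

/-- [folklore] **COMPOSITION**: `Φ` `Λ`-Lipschitz on `S` into `S′`, `Ψ` `Λ′`-Lipschitz on `S′`, `Λ′ ≥ 0` ⟹ `Ψ ∘ Φ` is
`Λ′Λ`-Lipschitz on `S` (e.g. inverse ∘ sandwich, sandwich ∘ inverse ∘ affine). -/
theorem OpLipschitzOn.comp {S : Set E} {S' : Set F} {Φ : E → F} {Ψ : F → G} {Λ Λ' : ℝ} (hΨ : OpLipschitzOn S' Ψ Λ')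
    (hΦ : OpLipschitzOn S Φ Λ) (hmaps : Set.MapsTo Φ S S') (hΛ' : 0 ≤ Λ') :
    OpLipschitzOn S (Ψ ∘ Φ) (Λ' * Λ) := fun _ hX _ hY =>
  (hΨ (hmaps hX) (hmaps hY)).trans (by rw [mul_assoc]; exact mul_le_mul_of_nonneg_left (hΦ hX hY) hΛ')

/-- [folklore] **AFFINE IMAGES** `X ↦ A₀ + β•X` are `‖β‖`-Lipschitz everywhere (e.g. the `δ`-function operator of a Gaussian
average, `Δ_k = a − a²·c_k` in the sandwiched resolvent `c_k` — model level). -/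
theorem opLipschitzOn_affine {𝕜 : Type*} [NormedField 𝕜] [NormedSpace 𝕜 E] (A₀ : E) (β : 𝕜) :
    OpLipschitzOn Set.univ (fun X : E => A₀ + β • X) ‖β‖ := fun X _ Y _ => by
  rw [add_sub_add_left_eq_sub, ← smul_sub, norm_smul]

/-- [folklore] **TRANSPORT OF A TWO-LEVEL OPERATOR-NORM RATE**: if `‖c_{k+1} − c_k‖ ≤ C·ρ^k`, every `c_k ∈ S` and `Φ` is
`Λ`-Lipschitz on `S` (`Λ ≥ 0`), then `‖Φ(c_{k+1}) − Φ(c_k)‖ ≤ ΛC·ρ^k`. -/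
theorem OpLipschitzOn.twoLevel_opRate {S : Set E} {Φ : E → F} {Λ : ℝ} (hΦ : OpLipschitzOn S Φ Λ) (hΛ : 0 ≤ Λ)
    {c : ℕ → E} (hS : ∀ k, c k ∈ S) {C ρ : ℝ} (hrate : ∀ k, ‖c (k + 1) - c k‖ ≤ C * ρ ^ k) (k : ℕ) :
    ‖Φ (c (k + 1)) - Φ (c k)‖ ≤ Λ * C * ρ ^ k :=
  calc ‖Φ (c (k + 1)) - Φ (c k)‖ ≤ Λ * ‖c (k + 1) - c k‖ := hΦ (hS _) (hS _)
    _ ≤ Λ * (C * ρ ^ k) := mul_le_mul_of_nonneg_left (hrate k) hΛ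
    _ = Λ * C * ρ ^ k := (mul_assoc _ _ _).symm

end Lipschitz

section MatrixImages

variable {n m : Type*} [Fintype n] [DecidableEq n] [Fintype m] [DecidableEq m]

/-- [folklore] **FIXED SANDWICHES** `X ↦ P·X·Q` are `‖P‖‖Q‖`-Lipschitz everywhere (e.g. `C*(·)C`, restrictions `Z₀^c`, the
parametrisation of the constraint surface — k-independent unit-lattice matrices; model level). -/
theorem opLipschitzOn_sandwich (P : Matrix m n ℂ) (Q : Matrix n m ℂ) :
    OpLipschitzOn Set.univ (fun X : Matrix n n ℂ => P * X * Q) (‖P‖ * ‖Q‖) := fun X _ Y _ => by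
  have e : P * X * Q - P * Y * Q = P * (X - Y) * Q := by rw [Matrix.mul_sub, Matrix.sub_mul]
  rw [e]
  calc ‖P * (X - Y) * Q‖ ≤ ‖P * (X - Y)‖ * ‖Q‖ := Matrix.l2_opNorm_mul _ _
    _ ≤ ‖P‖ * ‖X - Y‖ * ‖Q‖ := mul_le_mul_of_nonneg_right (Matrix.l2_opNorm_mul _ _) (norm_nonneg _)
    _ = ‖P‖ * ‖Q‖ * ‖X - Y‖ := by ring

/-- [folklore] **INVERSES ON UNIFORMLY COERCIVE MATRICES** are `γ⁻²`-Lipschitz: `CoerciveInverseTower.opNorm_inv_sub_inv_le` BY NAME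
(`‖A⁻¹ − B⁻¹‖ ≤ γ⁻²‖A − B‖` for `γ`-coercive `A, B`, `γ > 0`). -/
theorem opLipschitzOn_inv {γ : ℝ} (hγ : 0 < γ) :
    OpLipschitzOn {X : Matrix n n ℂ | Coercive γ X} (fun X => X⁻¹) ((γ⁻¹) ^ 2) := fun _ hX _ hY =>
  opNorm_inv_sub_inv_le hγ hX hY

/-- [folklore] **KING's (4.38) TWO-LEVEL SHAPE FOR LIPSCHITZ IMAGES**: a two-level operator-norm rate `(C, ρ)` of a family staying in
`S` (`ρ ≥ 0`), a `Λ`-Lipschitz `Φ` on `S` (`Λ ≥ 0`) into unit-lattice operators, and a level-UNIFORM entry decay `(B, δ)` of the images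
⟹ `TwoLevelDecayRate dist (Φ ∘ c) √(2B·ΛC) (δ∕2) √ρ` (`DecayRateInterpolation.twoLevelDecayRate_of_opNorm_of_entryDecay`). -/
theorem OpLipschitzOn.twoLevelDecayRate_image {E : Type*} [SeminormedAddCommGroup E] {S : Set E} {Φ : E → Matrix m m ℂ}
    {Λ : ℝ} (hΦ : OpLipschitzOn S Φ Λ) (hΛ : 0 ≤ Λ) {c : ℕ → E} (hS : ∀ k, c k ∈ S) {C ρ : ℝ} (hρ : 0 ≤ ρ)
    (hrate : ∀ k, ‖c (k + 1) - c k‖ ≤ C * ρ ^ k) {dist : m → m → ℝ} {B δ : ℝ} (hdec : ∀ k, EntryDecay dist (Φ (c k)) B δ) :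
    TwoLevelDecayRate dist (fun k => Φ (c k)) (Real.sqrt (2 * B * (Λ * C))) (δ / 2) (Real.sqrt ρ) :=
  twoLevelDecayRate_of_opNorm_of_entryDecay hρ (fun k => hΦ.twoLevel_opRate hΛ hS hrate k) hdec

end MatrixImages

/-! ## §2 The readings of the Δ species and of the constituent on the tower road (generic) -/

section Readings

variable {T κ ι Ω 𝒴 Bg J m : Type*}

/-- HYPOTHESIS SHAPE **`ReadsTowerDeltaA`** (READING, an identification): at every step `k` of the window, slot `t` and entry `(i, j)`,
run A's raw `deltaKer` entry IS the entry `(σX t i, σX t j)` of the level-`k` image `dk (tow k g U) t k` of the member `tow k g U` at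
slot `t`.  `rfl` for a supplier so defined. [folklore] -/
@[folklore]
def ReadsTowerDeltaA (dk : J → T → ℕ → Matrix m m ℂ) (σX : T → ι → m) (tow : ℕ → (ℕ → ℝ) → Bg → J)
    (rawA : (ℕ → ℝ) → Bg → ℕ → RawSpecies T κ ι Ω 𝒴) (W : Set (ℕ → ℝ)) : Prop :=
  ∀ k, ∀ g ∈ W, ∀ (U : Bg) (t : T) (i j : ι), (rawA g U k).deltaKer t i j = dk (tow k g U) t k (σX t i) (σX t j)

/-- HYPOTHESIS SHAPE **`ReadsTowerDeltaB`**: run B's raw `deltaKer` entry at the paired step IS the entry of the level-`k + 1` image of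
the SAME member at the SAME slot (the tower road's MI-R). [folklore] -/
@[folklore]
def ReadsTowerDeltaB (dk : J → T → ℕ → Matrix m m ℂ) (σX : T → ι → m) (tow : ℕ → (ℕ → ℝ) → Bg → J)
    (rawB : (ℕ → ℝ) → Bg → ℕ → RawSpecies T κ ι Ω 𝒴) (W : Set (ℕ → ℝ)) : Prop :=
  ∀ k, ∀ g ∈ W, ∀ (U : Bg) (t : T) (i j : ι), (rawB g U k).deltaKer t i j = dk (tow k g U) t (k + 1) (σX t i) (σX t j)

/-- HYPOTHESIS SHAPE **`ReadsTowerGammaA`**: run A's raw `gammaConstituent` entry `(a′, i)` at slot `t`, step `k`, IS the entry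
`(σB t a′, σX t i)` of the level-`k` image `gm (tow k g U) t k` (bond sites and X-sites both read into the image's index type). [folklore] -/
@[folklore]
def ReadsTowerGammaA (gm : J → T → ℕ → Matrix m m ℂ) (σB : T → κ → m) (σX : T → ι → m) (tow : ℕ → (ℕ → ℝ) → Bg → J)
    (rawA : (ℕ → ℝ) → Bg → ℕ → RawSpecies T κ ι Ω 𝒴) (W : Set (ℕ → ℝ)) : Prop :=
  ∀ k, ∀ g ∈ W, ∀ (U : Bg) (t : T) (a' : κ) (i : ι), (rawA g U k).gammaConstituent t a' i = gm (tow k g U) t k (σB t a') (σX t i)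

/-- HYPOTHESIS SHAPE **`ReadsTowerGammaB`**: run B's raw `gammaConstituent` entry IS the level-`k + 1` entry of the same image. [folklore] -/
@[folklore]
def ReadsTowerGammaB (gm : J → T → ℕ → Matrix m m ℂ) (σB : T → κ → m) (σX : T → ι → m) (tow : ℕ → (ℕ → ℝ) → Bg → J)
    (rawB : (ℕ → ℝ) → Bg → ℕ → RawSpecies T κ ι Ω 𝒴) (W : Set (ℕ → ℝ)) : Prop :=
  ∀ k, ∀ g ∈ W, ∀ (U : Bg) (t : T) (a' : κ) (i : ι),
    (rawB g U k).gammaConstituent t a' i = gm (tow k g U) t (k + 1) (σB t a') (σX t i)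

/-- HYPOTHESIS SHAPE (the `deltaKer` block of the step-`k` format DOMINATES `e^{−δ·dist}` read through the slot's index map — e.g.
`B13Weights.format`, weight `e^{−2δ′d(p i, p j)}` with `2δ′·d(p i, p j) ≤ δ·dist(σX t i, σX t j)`). [folklore] -/
@[folklore]
def DeltaWeightDominatesDist (Fk : ℕ → Format (Species T κ ι Ω 𝒴)) (dist : m → m → ℝ) (σX : T → ι → m) (δ : ℝ) : Prop :=
  ∀ (k : ℕ) (t : T) (i j : ι), Real.exp (-(δ * dist (σX t i) (σX t j))) ≤ (Fk k).wt (.deltaKer t i j)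

/-- HYPOTHESIS SHAPE (the `gammaConstituent` block of the step-`k` format dominates `e^{−δ·dist}` through the two index maps). [folklore] -/
@[folklore]
def GammaWeightDominatesDist (Fk : ℕ → Format (Species T κ ι Ω 𝒴)) (dist : m → m → ℝ) (σB : T → κ → m) (σX : T → ι → m)
    (δ : ℝ) : Prop :=
  ∀ (k : ℕ) (t : T) (a' : κ) (i : ι), Real.exp (-(δ * dist (σB t a') (σX t i))) ≤ (Fk k).wt (.gammaConstituent t a' i)

/-- [folklore] ONE RUN, `deltaKer`: level-uniform entry decay `(B, δ)` of every image + the reading + domination ⟹ the `deltaKer`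
conjunct of `SpeciesFormatBy` with radius `B` at every step of the window. -/
theorem deltaKer_formatBy_of_entryDecay {Fk : ℕ → Format (Species T κ ι Ω 𝒴)} {dk : J → T → ℕ → Matrix m m ℂ}
    {σX : T → ι → m} {tow : ℕ → (ℕ → ℝ) → Bg → J} {rawA : (ℕ → ℝ) → Bg → ℕ → RawSpecies T κ ι Ω 𝒴} {W : Set (ℕ → ℝ)}
    {dist : m → m → ℝ} {B δ : ℝ} (hB : 0 ≤ B) (hdec : ∀ j t k, EntryDecay dist (dk j t k) B δ)
    (hread : ReadsTowerDeltaA dk σX tow rawA W) (hdom : DeltaWeightDominatesDist Fk dist σX δ) (k : ℕ) {g : ℕ → ℝ}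
    (hg : g ∈ W) (U : Bg) (t : T) (i j : ι) : ‖(rawA g U k).deltaKer t i j‖ ≤ B * (Fk k).wt (.deltaKer t i j) := by
  rw [hread k g hg U t i j]
  exact (hdec (tow k g U) t k (σX t i) (σX t j)).trans (mul_le_mul_of_nonneg_left (hdom k t i j) hB)

/-- [folklore] **TWO RUNS, `deltaKer` — THE DECAY-CURRENCY TOWER READING**: King's two-level shape `(B, δ, θ)` for every image family
`dk j t` + the two readings + domination ⟹ `‖rawA.deltaKer t i j − rawB.deltaKer t i j‖ ≤ B·θ^k·wt(.deltaKer t i j)` at every step of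
the window — the `SpeciesEntryBound` `deltaKer` conjunct of W1 OF RECORD, NO `1 ∕ min wt` loss. -/
theorem deltaKer_entryBound_of_twoLevelDecayRate {Fk : ℕ → Format (Species T κ ι Ω 𝒴)} {dk : J → T → ℕ → Matrix m m ℂ}
    {σX : T → ι → m} {tow : ℕ → (ℕ → ℝ) → Bg → J} {rawA rawB : (ℕ → ℝ) → Bg → ℕ → RawSpecies T κ ι Ω 𝒴}
    {W : Set (ℕ → ℝ)} {dist : m → m → ℝ} {B δ θ : ℝ} (hB : 0 ≤ B) (hθ : 0 ≤ θ)
    (hrate : ∀ j t, TwoLevelDecayRate dist (dk j t) B δ θ) (hreadA : ReadsTowerDeltaA dk σX tow rawA W)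
    (hreadB : ReadsTowerDeltaB dk σX tow rawB W) (hdom : DeltaWeightDominatesDist Fk dist σX δ) (k : ℕ) {g : ℕ → ℝ}
    (hg : g ∈ W) (U : Bg) (t : T) (i j : ι) :
    ‖(rawA g U k).deltaKer t i j - (rawB g U k).deltaKer t i j‖ ≤ B * θ ^ k * (Fk k).wt (.deltaKer t i j) := by
  rw [hreadA k g hg U t i j, hreadB k g hg U t i j, norm_sub_rev, ← Matrix.sub_apply]
  exact (hrate (tow k g U) t k (σX t i) (σX t j)).trans
    (mul_le_mul_of_nonneg_left (hdom k t i j) (mul_nonneg hB (pow_nonneg hθ k)))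

/-- [folklore] ONE RUN, `gammaConstituent`: as `deltaKer_formatBy_of_entryDecay` with the two index maps. -/
theorem gammaConstituent_formatBy_of_entryDecay {Fk : ℕ → Format (Species T κ ι Ω 𝒴)} {gm : J → T → ℕ → Matrix m m ℂ}
    {σB : T → κ → m} {σX : T → ι → m} {tow : ℕ → (ℕ → ℝ) → Bg → J} {rawA : (ℕ → ℝ) → Bg → ℕ → RawSpecies T κ ι Ω 𝒴}
    {W : Set (ℕ → ℝ)} {dist : m → m → ℝ} {B δ : ℝ} (hB : 0 ≤ B) (hdec : ∀ j t k, EntryDecay dist (gm j t k) B δ)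
    (hread : ReadsTowerGammaA gm σB σX tow rawA W) (hdom : GammaWeightDominatesDist Fk dist σB σX δ) (k : ℕ) {g : ℕ → ℝ}
    (hg : g ∈ W) (U : Bg) (t : T) (a' : κ) (i : ι) :
    ‖(rawA g U k).gammaConstituent t a' i‖ ≤ B * (Fk k).wt (.gammaConstituent t a' i) := by
  rw [hread k g hg U t a' i]
  exact (hdec (tow k g U) t k (σB t a') (σX t i)).trans (mul_le_mul_of_nonneg_left (hdom k t a' i) hB)

/-- [folklore] **TWO RUNS, `gammaConstituent`**: King's two-level shape for every image family `gm j t` + the two readings + domination ⟹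
`‖rawA.gammaConstituent t a′ i − rawB.gammaConstituent t a′ i‖ ≤ B·θ^k·wt` — the `SpeciesEntryBound` `gammaConstituent` conjunct. -/
theorem gammaConstituent_entryBound_of_twoLevelDecayRate {Fk : ℕ → Format (Species T κ ι Ω 𝒴)} {gm : J → T → ℕ → Matrix m m ℂ}
    {σB : T → κ → m} {σX : T → ι → m} {tow : ℕ → (ℕ → ℝ) → Bg → J} {rawA rawB : (ℕ → ℝ) → Bg → ℕ → RawSpecies T κ ι Ω 𝒴}
    {W : Set (ℕ → ℝ)} {dist : m → m → ℝ} {B δ θ : ℝ} (hB : 0 ≤ B) (hθ : 0 ≤ θ)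
    (hrate : ∀ j t, TwoLevelDecayRate dist (gm j t) B δ θ) (hreadA : ReadsTowerGammaA gm σB σX tow rawA W)
    (hreadB : ReadsTowerGammaB gm σB σX tow rawB W) (hdom : GammaWeightDominatesDist Fk dist σB σX δ) (k : ℕ) {g : ℕ → ℝ}
    (hg : g ∈ W) (U : Bg) (t : T) (a' : κ) (i : ι) :
    ‖(rawA g U k).gammaConstituent t a' i - (rawB g U k).gammaConstituent t a' i‖ ≤
      B * θ ^ k * (Fk k).wt (.gammaConstituent t a' i) := by
  rw [hreadA k g hg U t a' i, hreadB k g hg U t a' i, norm_sub_rev, ← Matrix.sub_apply]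
  exact (hrate (tow k g U) t k (σB t a') (σX t i)).trans
    (mul_le_mul_of_nonneg_left (hdom k t a' i) (mul_nonneg hB (pow_nonneg hθ k)))

end Readings

end Summit.QuantumFields.BalabanUV.T4Continuum.B13ReadingsImage

end
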